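import Summits.QuantumFields.YangMills.Theorems.UnitScaleTiltProp7HPcolNegPauliExp
import Summits.QuantumFields.YangMills.Theorems.UnitScaleTiltProp7NestedMeanParallelLift
import Literature.MathematicalPhysics.QuantumFieldTheory.Balaban1983to89.BlockAveragingTowerStraightTransportTowers
import HarnessLib

/-!
# Route `UnitScaleTilt`, crux K1 «MinimiserStabilityRegPr» (stmt-QuantumFields-19200), EX display footnote 17v — NEG-hPcol piece (N5)
# **«A `D_{U_s}`-PARALLEL GAUGE PARAMETER IS A CONSTANT SCALAR»**: px12 g11's explicit stratum-(c) family `U_s` is IRREDUCIBLE.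

Cell `ym3-torus` (HUMAN RULING D-0037, YM ladder rung R3 — continuum SU(2) YM₃ on T³; NOT d = 4, NOT infinite volume, NOT a mass gap, NOT the Clay
problem), width seat `ym-routeR-w3` gen 11, on px12 g11's word «routeR-w3 g11: N5 GO» (★★OWNER WORD 38 «NEG-hPcol — GO, LOW PRIORITY», ACK 108 «`Neg`»).
THEOREMS ONLY (0 `def`, 0 `sorry`, default heartbeats); `--supports stmt-QuantumFields-19200 --as helper`; count-neutral.  NOT an item refutation, NOT a
display event, NOT progress on EX: one lattice input of px12's footnote-17v certificate «the S42ᴸ row `hPcol` AS DISPLAYED is not inhabitable».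

WHAT.  For the background `U_s(b) = expHerm (s·θ((b₋)_{dir b} mod L) • σ_{dir b})`, `θ(0) = 1`, `θ(1) = −1`, `θ = 0` else (px12 g11 SPEC-0 e654b2a4,
family v2.1 8aced68d), every `0 < s ≤ 1` and every `λ : T_K → M₂(ℂ)` with `D_{U_s}λ = 0` ((3.3) of [Balaban1985BackgroundPropagators]) is a CONSTANT
SCALAR `λ ≡ z·1`.  HOW.  §4: `D_{U_s}λ = 0` says `Ad_{U_s(b)}λ(b₊) = λ(b₋)` on every bond (✓`toL2_symm_DL2_toL2S_eq`), so `λ(x)` commutes with the holonomy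
of every closed word at `x` (✓`conjR_holT_of_parallel`, §3); at the origin the plaquette words in the planes `(0,1)`, `(0,2)` read `U_s` only at bonds whose
relevant coordinate is `0 (mod L)` (`θ = 1`), so their holonomies are `P₀ν = E₀E_νE₀(−s)E_ν(−s)`, `E_μ(t) = e^{itσ_μ} = cos t·1 + i sin t·σ_μ`
(✓`coe_expHerm_smul_pauli_eq`, px6 g11 N2a); §1–§2: a `2×2` matrix commuting with `P₀₁`, `P₀₂` is scalar since `(P₀₁)₀₁ = (−2+2i)cos s sin³s ≠ 0` and
`(P₀₁)₁₀(P₀₂)₀₁ − (P₀₁)₀₁(P₀₂)₁₀ = 8i cos²s sin⁵s (cos s + sin s) ≠ 0` (`0 < s ≤ 1 < π/2`); §3: a scalar value propagates along every bond.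
[cite: Balaban1985BackgroundPropagators, (3.3) p.391, (3.21) p.394; Balaban1985Averaging, (8)-(9) pp.18-19]
-/
set_option autoImplicit false

noncomputable section

open scoped BigOperators Matrix.Norms.L2Operator

namespace Summit.QuantumFields.YangMills.Theorems.Prop7HPcolNegIrreducible

open NormedSpace (exp)
open Literature.MathematicalPhysics.QuantumLattice (spinHalfPauli)
open Literature.MathematicalPhysics.QuantumFieldTheory.Balaban1983to89
open Literature.MathematicalPhysics.QuantumFieldTheory.Balaban1983to89.T3ContinuumYM3Torus
open Literature.MathematicalPhysics.QuantumFieldTheory.Balaban1983to89.T3SectALandauChart (bgUnits eta eta_pos)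
open B7Prop1Explicit (Letter)
open T4Continuum (walkEnd)
open B7Eq78Linearization (conjR conjR_apply)
open B8Ineq132 (conjR_conjR one_conjR)
open BlockAveragingTowerStraightTransportTowers (iterate_shift_apply)
open B10Eq27TorusAxialLog (holT holT_nil holT_cons_true holT_cons_false unitsField toUField val_holT_unitsField holT_toUField)
open Summit.QuantumFields.YangMills.Theorems.Prop7TPrint (expHerm expHermField expHermField_apply)
open Summit.QuantumFields.YangMills.Theorems.Prop7SectET3HilbertLetters (toL2 toL2S DL2)
open Summit.QuantumFields.YangMills.Theorems.Prop7NestedMeanParallelLift (conjR_holT_of_parallel commute_of_conjR_eq toL2_symm_DL2_toL2S_eq)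
open Summit.QuantumFields.YangMills.Theorems.Prop7HPcolNegPauliExp (coe_expHerm_smul_pauli_eq expHerm_smul_pauli_inv)

/-! ## §1 A `2×2` matrix commuting with two sufficiently generic matrices is scalar -/

section TwoByTwo

/-- **Entrywise double-commutant criterion in `M₂(ℂ)`**: if `Y` commutes with `g` and with `h`, `g₀₁ ≠ 0` and `g₁₀h₀₁ − g₀₁h₁₀ ≠ 0`, then `Y` is a scalar
(from `Yg = gY`: `Y₀₁g₁₀ = g₀₁Y₁₀` and `g₀₁(Y₀₀ − Y₁₁) = Y₀₁(g₀₀ − g₁₁)`; the same for `h`; eliminate). [folklore] -/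
theorem eq_smul_one_of_commute_pair {g h Y : Matrix (Fin 2) (Fin 2) ℂ} (hg : Y * g = g * Y) (hh : Y * h = h * Y)
    (hg01 : g 0 1 ≠ 0) (hΔ : g 1 0 * h 0 1 - g 0 1 * h 1 0 ≠ 0) : ∃ z : ℂ, Y = z • (1 : Matrix (Fin 2) (Fin 2) ℂ) := by
  have e00 := congrFun (congrFun hg 0) 0
  have e01 := congrFun (congrFun hg 0) 1
  have f00 := congrFun (congrFun hh 0) 0
  simp only [Matrix.mul_apply, Fin.sum_univ_two] at e00 e01 f00
  -- `Y₀₁ g₁₀ = g₀₁ Y₁₀`, `Y₀₁ h₁₀ = h₀₁ Y₁₀`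
  have a1 : Y 0 1 * g 1 0 = g 0 1 * Y 1 0 := by linear_combination e00
  have a2 : Y 0 1 * h 1 0 = h 0 1 * Y 1 0 := by linear_combination f00
  have hY01 : Y 0 1 = 0 := by
    have : Y 0 1 * (g 1 0 * h 0 1 - g 0 1 * h 1 0) = 0 := by linear_combination h 0 1 * a1 - g 0 1 * a2
    rcases mul_eq_zero.mp this with h0 | h0
    · exact h0
    · exact absurd h0 hΔ
  have hY10 : Y 1 0 = 0 := by
    have : g 0 1 * Y 1 0 = 0 := by rw [← a1, hY01, zero_mul]
    rcases mul_eq_zero.mp this with h0 | h0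
    · exact absurd h0 hg01
    · exact h0
  have hdiag : Y 0 0 = Y 1 1 := by
    have : g 0 1 * (Y 0 0 - Y 1 1) = 0 := by linear_combination e01 + (g 0 0 - g 1 1) * hY01
    rcases mul_eq_zero.mp this with h0 | h0
    · exact absurd h0 hg01
    · exact sub_eq_zero.mp h0
  refine ⟨Y 0 0, ?_⟩
  ext i j
  fin_cases i <;> fin_cases j
  · simp
  · simp [hY01]
  · simp [hY10]
  · simp [hdiag]

end TwoByTwo

/-! ## §2 The two plaquette holonomies of `U_s` at the origin, as explicit matrices, and their genericity -/

section Plaquettes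

/-- The one-axis exponentials in Euler form, as matrix literals: `cos s·1 + i d·σ₀ = [[c, id],[id, c]]` (`c d : ℂ` arbitrary). [folklore] -/
theorem euler_zero_eq (c d : ℂ) :
    c • (1 : Matrix (Fin 2) (Fin 2) ℂ) + (Complex.I * d) • spinHalfPauli 0 = !![c, Complex.I * d; Complex.I * d, c] := by
  ext i j; fin_cases i <;> fin_cases j <;> simp [spinHalfPauli]

/-- `c·1 + i d·σ₁ = [[c, d],[−d, c]]`. [folklore] -/
theorem euler_one_eq (c d : ℂ) :
    c • (1 : Matrix (Fin 2) (Fin 2) ℂ) + (Complex.I * d) • spinHalfPauli 1 = !![c, d; -d, c] := by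
  ext i j; fin_cases i <;> fin_cases j <;> simp [spinHalfPauli, mul_comm Complex.I d, mul_assoc]

/-- `c·1 + i d·σ₂ = [[c + id, 0],[0, c − id]]`. [folklore] -/
theorem euler_two_eq (c d : ℂ) :
    c • (1 : Matrix (Fin 2) (Fin 2) ℂ) + (Complex.I * d) • spinHalfPauli 2 = !![c + Complex.I * d, 0; 0, c - Complex.I * d] := by
  ext i j; fin_cases i <;> fin_cases j <;> simp [spinHalfPauli, sub_eq_add_neg]


/-- The inverse factors: `c·1 + i(−d)·σ₀ = [[c, −id],[−id, c]]`. [folklore] -/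
theorem euler_zero_neg_eq (c d : ℂ) :
    c • (1 : Matrix (Fin 2) (Fin 2) ℂ) + (Complex.I * -d) • spinHalfPauli 0 = !![c, -(Complex.I * d); -(Complex.I * d), c] := by
  ext i j; fin_cases i <;> fin_cases j <;> simp [spinHalfPauli]

/-- `c·1 + i(−d)·σ₁ = [[c, −d],[d, c]]`. [folklore] -/
theorem euler_one_neg_eq (c d : ℂ) :
    c • (1 : Matrix (Fin 2) (Fin 2) ℂ) + (Complex.I * -d) • spinHalfPauli 1 = !![c, -d; d, c] := by
  ext i j; fin_cases i <;> fin_cases j <;> simp [spinHalfPauli, mul_comm Complex.I, mul_assoc]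

/-- `c·1 + i(−d)·σ₂ = [[c − id, 0],[0, c + id]]`. [folklore] -/
theorem euler_two_neg_eq (c d : ℂ) :
    c • (1 : Matrix (Fin 2) (Fin 2) ℂ) + (Complex.I * -d) • spinHalfPauli 2 = !![c - Complex.I * d, 0; 0, c + Complex.I * d] := by
  ext i j; fin_cases i <;> fin_cases j <;> simp [spinHalfPauli, sub_eq_add_neg]

/-- The `(0,1)` entry of the plaquette word `P₀₁ = E₀E₁E₀⁻¹E₁⁻¹` (`E_μ^{±1} = c·1 ± i d·σ_μ`): `(−2 + 2i)·c·d³`. [folklore] -/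
theorem plaq01_apply_01 (c d : ℂ) :
    (!![c, Complex.I * d; Complex.I * d, c] * !![c, d; -d, c] * !![c, -(Complex.I * d); -(Complex.I * d), c] * !![c, -d; d, c]) 0 1 =
      (-2 + 2 * Complex.I) * c * d ^ 3 := by
  simp [Matrix.mul_apply, Fin.sum_univ_two]
  ring_nf
  rw [Complex.I_sq]
  ring

/-- The `(1,0)` entry of `P₀₁`: `(2 + 2i)·c·d³`. [folklore] -/
theorem plaq01_apply_10 (c d : ℂ) :
    (!![c, Complex.I * d; Complex.I * d, c] * !![c, d; -d, c] * !![c, -(Complex.I * d); -(Complex.I * d), c] * !![c, -d; d, c]) 1 0 =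
      (2 + 2 * Complex.I) * c * d ^ 3 := by
  simp [Matrix.mul_apply, Fin.sum_univ_two]
  ring_nf
  rw [Complex.I_sq]
  ring

/-- The `(0,1)` entry of the plaquette word `P₀₂ = E₀E₂E₀⁻¹E₂⁻¹`: `2i·c·d³ + 2·c²·d²`. [folklore] -/
theorem plaq02_apply_01 (c d : ℂ) :
    (!![c, Complex.I * d; Complex.I * d, c] * !![c + Complex.I * d, 0; 0, c - Complex.I * d] *
        !![c, -(Complex.I * d); -(Complex.I * d), c] * !![c - Complex.I * d, 0; 0, c + Complex.I * d]) 0 1 =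
      2 * Complex.I * c * d ^ 3 + 2 * c ^ 2 * d ^ 2 := by
  simp [Matrix.mul_apply, Fin.sum_univ_two]
  ring_nf
  rw [Complex.I_sq]
  ring_nf
  rw [show Complex.I ^ 3 = Complex.I ^ 2 * Complex.I from by ring, Complex.I_sq]
  ring

/-- The `(1,0)` entry of `P₀₂`: `2i·c·d³ − 2·c²·d²`. [folklore] -/
theorem plaq02_apply_10 (c d : ℂ) :
    (!![c, Complex.I * d; Complex.I * d, c] * !![c + Complex.I * d, 0; 0, c - Complex.I * d] *
        !![c, -(Complex.I * d); -(Complex.I * d), c] * !![c - Complex.I * d, 0; 0, c + Complex.I * d]) 1 0 =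
      2 * Complex.I * c * d ^ 3 - 2 * c ^ 2 * d ^ 2 := by
  simp [Matrix.mul_apply, Fin.sum_univ_two]
  ring_nf
  rw [Complex.I_sq]
  ring_nf
  rw [show Complex.I ^ 3 = Complex.I ^ 2 * Complex.I from by ring, Complex.I_sq]
  ring

/-- ★ **A `2×2` matrix commuting with both plaquette holonomies `P₀₁(s)`, `P₀₂(s)` of the explicit family is scalar, for `cos s > 0`, `sin s > 0`**
(`(P₀₁)₀₁ = (−2+2i)cd³ ≠ 0`, `(P₀₁)₁₀(P₀₂)₀₁ − (P₀₁)₀₁(P₀₂)₁₀ = 8i·c²d⁵(c + d) ≠ 0`; §1). [folklore] -/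
theorem eq_smul_one_of_commute_plaquettes {c d : ℝ} (hc : 0 < c) (hd : 0 < d) {Y : Matrix (Fin 2) (Fin 2) ℂ}
    (h01 : Y * (!![(c : ℂ), Complex.I * d; Complex.I * d, c] * !![(c : ℂ), d; -d, c] * !![(c : ℂ), -(Complex.I * d); -(Complex.I * d), c] * !![(c : ℂ), -d; d, c]) =
      (!![(c : ℂ), Complex.I * d; Complex.I * d, c] * !![(c : ℂ), d; -d, c] * !![(c : ℂ), -(Complex.I * d); -(Complex.I * d), c] * !![(c : ℂ), -d; d, c]) * Y)
    (h02 : Y * (!![(c : ℂ), Complex.I * d; Complex.I * d, c] * !![(c : ℂ) + Complex.I * d, 0; 0, c - Complex.I * d] *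
        !![(c : ℂ), -(Complex.I * d); -(Complex.I * d), c] * !![(c : ℂ) - Complex.I * d, 0; 0, c + Complex.I * d]) =
      (!![(c : ℂ), Complex.I * d; Complex.I * d, c] * !![(c : ℂ) + Complex.I * d, 0; 0, c - Complex.I * d] *
        !![(c : ℂ), -(Complex.I * d); -(Complex.I * d), c] * !![(c : ℂ) - Complex.I * d, 0; 0, c + Complex.I * d]) * Y) :
    ∃ z : ℂ, Y = z • (1 : Matrix (Fin 2) (Fin 2) ℂ) := by
  have hc' : (c : ℂ) ≠ 0 := by exact_mod_cast hc.ne'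
  have hd' : (d : ℂ) ≠ 0 := by exact_mod_cast hd.ne'
  have hcd : ((c : ℂ) + d) ≠ 0 := by exact_mod_cast (add_pos hc hd).ne'
  refine eq_smul_one_of_commute_pair h01 h02 ?_ ?_
  · rw [plaq01_apply_01]
    have h22 : (-2 + 2 * Complex.I) ≠ 0 := by
      intro h
      have := congrArg Complex.re h
      simp at this
    exact mul_ne_zero (mul_ne_zero h22 hc') (pow_ne_zero 3 hd')
  · rw [plaq01_apply_01, plaq01_apply_10, plaq02_apply_01, plaq02_apply_10]
    have h8 : (2 + 2 * Complex.I) * c * d ^ 3 * (2 * Complex.I * c * d ^ 3 + 2 * c ^ 2 * d ^ 2) -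
        (-2 + 2 * Complex.I) * c * d ^ 3 * (2 * Complex.I * c * d ^ 3 - 2 * c ^ 2 * d ^ 2) =
        8 * Complex.I * (c : ℂ) ^ 2 * d ^ 5 * (c + d) := by ring
    rw [h8]
    exact mul_ne_zero (mul_ne_zero (mul_ne_zero (mul_ne_zero (by norm_num) Complex.I_ne_zero) (pow_ne_zero 2 hc')) (pow_ne_zero 5 hd')) hcd

end Plaquettes

/-! ## §3 Lattice: parallel sections, holonomies of closed words, the two plaquettes at the origin, propagation -/

section Lattice

variable {P : Params}

/-- `((x + e_μ) + e_ν) − e_μ = x + e_ν` on the torus sites. [cite: Balaban1987RG1, (0.1) p.251] -/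
theorem unshift_shift_shift {j : ℕ} (x : Site P j) {μ ν : Fin P.d} (hμν : μ ≠ ν) : ((x.shift μ).shift ν).unshift μ = x.shift ν := by
  funext κ
  by_cases hκμ : κ = μ
  · subst hκμ
    simp [Site.shift, Site.unshift, Function.update_of_ne hμν]
  · by_cases hκν : κ = ν
    · subst hκν
      simp [Site.shift, Site.unshift, Function.update_of_ne hκμ]
    · simp [Site.shift, Site.unshift, Function.update_of_ne hκμ, Function.update_of_ne hκν]

variable {𝔸 : Type*} [NormedRing 𝔸]

/-- **A parallel section commutes with the holonomy of every CLOSED word** (✓`conjR_holT_of_parallel` at `walkEnd x w = x`). [cite: Balaban1985Averaging, (8)-(9) pp.18-19] -/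
theorem commute_holT_of_parallel {j : ℕ} (V : GaugeField P j 𝔸ˣ) (l : Site P j → 𝔸) (hpar : ∀ b : PBond P j, conjR (V b) (l b.tgt) = l b.src)
    (w : List (Letter P.d)) (x : Site P j) (hw : walkEnd x w = x) : Commute (l x) ((holT V x w : 𝔸ˣ) : 𝔸) := by
  have h := conjR_holT_of_parallel V l hpar w x
  rw [hw] at h
  exact commute_of_conjR_eq h

/-- **A scalar value of a parallel section propagates along every forward step** (`Ad_{V(b)}λ(b₊) = λ(b₋) = z·1` forces `λ(b₊) = z·1`). [cite: Balaban1985Averaging, (8) p.19] -/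
theorem eq_smul_one_shift_of_parallel [NormedAlgebra ℂ 𝔸] {j : ℕ} (V : GaugeField P j 𝔸ˣ) (l : Site P j → 𝔸) (hpar : ∀ b : PBond P j, conjR (V b) (l b.tgt) = l b.src)
    {z : ℂ} {x : Site P j} (hx : l x = z • (1 : 𝔸)) (μ : Fin P.d) : l (x.shift μ) = z • (1 : 𝔸) := by
  have h := hpar ⟨x, μ⟩
  change conjR (V ⟨x, μ⟩) (l (x.shift μ)) = l x at h
  rw [hx] at h
  have h2 : conjR (V ⟨x, μ⟩)⁻¹ (conjR (V ⟨x, μ⟩) (l (x.shift μ))) = conjR (V ⟨x, μ⟩)⁻¹ (z • (1 : 𝔸)) := by rw [h]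
  rw [conjR_conjR, inv_mul_cancel, one_conjR, B7Eq78Linearization.conjR_smul, B7Eq78Linearization.conjR_one] at h2
  exact h2

/-- Iterated form of `eq_smul_one_shift_of_parallel`. [cite: Balaban1985Averaging, (8) p.19] -/
theorem eq_smul_one_iterate_shift_of_parallel [NormedAlgebra ℂ 𝔸] {j : ℕ} (V : GaugeField P j 𝔸ˣ) (l : Site P j → 𝔸) (hpar : ∀ b : PBond P j, conjR (V b) (l b.tgt) = l b.src)
    {z : ℂ} (μ : Fin P.d) : ∀ (k : ℕ) {x : Site P j}, l x = z • (1 : 𝔸) → l ((fun y : Site P j => y.shift μ)^[k] x) = z • (1 : 𝔸)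
  | 0, _, hx => hx
  | k + 1, x, hx => by
    rw [Function.iterate_succ_apply]
    exact eq_smul_one_iterate_shift_of_parallel V l hpar μ k (eq_smul_one_shift_of_parallel V l hpar hx μ)

/-- **A parallel section that is a scalar at ONE site is that scalar EVERYWHERE** (every site is reached from `x₀` by forward steps, one direction at a time).
[cite: Balaban1985Averaging, (8)-(9) pp.18-19] -/
theorem eq_const_smul_one_of_parallel [NormedAlgebra ℂ 𝔸] {j : ℕ} (V : GaugeField P j 𝔸ˣ) (l : Site P j → 𝔸) (hpar : ∀ b : PBond P j, conjR (V b) (l b.tgt) = l b.src)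
    {z : ℂ} {x₀ : Site P j} (hx₀ : l x₀ = z • (1 : 𝔸)) : l = fun _ => z • (1 : 𝔸) := by
  classical
  -- induction on the set of coordinates in which `y` may differ from `x₀`
  suffices hS : ∀ (S : Finset (Fin P.d)) (y : Site P j), (∀ ν, ν ∉ S → y ν = x₀ ν) → l y = z • (1 : 𝔸) by
    funext y; exact hS Finset.univ y fun ν hν => absurd (Finset.mem_univ ν) hν
  intro S
  induction S using Finset.induction_on with
  | empty =>
    intro y hy
    have : y = x₀ := funext fun ν => hy ν (Finset.notMem_empty ν)
    rw [this, hx₀]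
  | insert μ S hμS ih =>
    intro y hy
    -- retract the `μ`-coordinate to `x₀ μ`, then walk back with `(y μ − x₀ μ).val` forward steps
    set y' : Site P j := Function.update y μ (x₀ μ) with hy'
    have hy'S : ∀ ν, ν ∉ S → y' ν = x₀ ν := by
      intro ν hν
      by_cases hνμ : ν = μ
      · subst hνμ; simp [hy']
      · rw [hy', Function.update_of_ne hνμ]; exact hy ν (by simp [hνμ, hν])
    have hl' : l y' = z • (1 : 𝔸) := ih y' hy'S
    have hreach : (fun w : Site P j => w.shift μ)^[(y μ - x₀ μ).val] y' = y := by
      funext ν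
      rw [iterate_shift_apply]
      by_cases hνμ : ν = μ
      · subst hνμ; simp [hy']
      · rw [if_neg hνμ, add_zero, hy', Function.update_of_ne hνμ]
    rw [← hreach]
    exact eq_smul_one_iterate_shift_of_parallel V l hpar μ _ hl'

end Lattice

/-! ## §4 The explicit family at the T³ member: the parallel condition, the two plaquettes at the origin, the headline -/

section Member

variable (F : T3Family) (K : ℕ)

/-- **THE (3.3) STENCIL READ BACKWARDS: `D_{U₀}(toL2S λ) = 0` ⟹ `Ad_{U₀♭(b)}λ(b₊) = λ(b₋)` on every bond** (✓`toL2_symm_DL2_toL2S_eq`, `η ≠ 0`).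
[cite: Balaban1985BackgroundPropagators, (3.3) p.391, (3.21) p.394] -/
theorem parallel_of_DL2_eq_zero (n : ℕ) (c₀ : ℝ) [Fact (0 < c₀)] (U₀ : GaugeField (F.P K) 0 (Matrix.specialUnitaryGroup (Fin 2) ℂ))
    (l : Site (F.P K) 0 → Matrix (Fin 2) (Fin 2) ℂ) (hl : DL2 F n K c₀ U₀ (toL2S F K c₀ l) = 0) :
    ∀ b : PBond (F.P K) 0, conjR (bgUnits F K U₀ b) (l b.tgt) = l b.src := by
  have h := toL2_symm_DL2_toL2S_eq F (n := n) (c₀ := c₀) U₀ l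
  rw [hl, map_zero] at h
  intro b
  have hb := congrFun h b
  rw [Pi.zero_apply] at hb
  have hη : (((eta F n K : ℝ) : ℂ)⁻¹) ≠ 0 := inv_ne_zero (by exact_mod_cast (eta_pos F n K).ne')
  rcases smul_eq_zero.mp hb.symm with h0 | h0
  · exact absurd h0 hη
  · exact sub_eq_zero.mp h0

/-- The holonomy of the units-valued background is the `SU(2)` holonomy read in `M₂(ℂ)`. [cite: Balaban1985Averaging, (9) p.19, (19) p.21] -/
theorem coe_holT_bgUnits (U₀ : GaugeField (F.P K) 0 (Matrix.specialUnitaryGroup (Fin 2) ℂ)) (x : Site (F.P K) 0) (w : List (Letter (F.P K).d)) :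
    ((holT (bgUnits F K U₀) x w : (Matrix (Fin 2) (Fin 2) ℂ)ˣ) : Matrix (Fin 2) (Fin 2) ℂ) =
      ((holT U₀ x w : Matrix.specialUnitaryGroup (Fin 2) ℂ) : Matrix (Fin 2) (Fin 2) ℂ) := by
  show ((holT (unitsField (toUField U₀)) x w : (Matrix (Fin 2) (Fin 2) ℂ)ˣ) : Matrix (Fin 2) (Fin 2) ℂ) = _
  rw [val_holT_unitsField, holT_toUField]
  rfl

/-- **THE PLAQUETTE WORD AT THE ORIGIN IN THE PLANE `(μ, ν)`** for a background whose bond value is `expHerm (s • σ_{dir b})` at every bond whose source has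
`dir b`-coordinate `0`: the `SU(2)` holonomy of `[+μ, +ν, −μ, −ν]` from `x₀ = 0` is `E_μ E_ν E_μ(−s) E_ν(−s)`, `E_κ(t) = expHerm (t • σ_κ)`.
[cite: Balaban1985Averaging, (9) p.18] -/
theorem holT_plaquette_origin (s : ℝ) (θ : PBond (F.P K) 0 → ℝ)
    (hθ : ∀ b : PBond (F.P K) 0, (b.src b.dir).val % F.L = 0 → θ b = s) {μ ν : Fin (F.P K).d} (hμν : μ ≠ ν) :
    holT (expHermField (F := F) (K := K) (fun b => ((θ b : ℝ) : ℂ) • spinHalfPauli b.dir)) (fun _ => 0) [(μ, true), (ν, true), (μ, false), (ν, false)] =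
      expHerm (((s : ℝ) : ℂ) • spinHalfPauli μ) * expHerm (((s : ℝ) : ℂ) • spinHalfPauli ν) *
        expHerm (((-s : ℝ) : ℂ) • spinHalfPauli μ) * expHerm (((-s : ℝ) : ℂ) • spinHalfPauli ν) := by
  set x₀ : Site (F.P K) 0 := fun _ => 0 with hx₀
  have hval : ∀ (y : Site (F.P K) 0) (κ : Fin (F.P K).d), y κ = 0 → θ ⟨y, κ⟩ = s := by
    intro y κ hy
    exact hθ ⟨y, κ⟩ (by show (y κ).val % F.L = 0; rw [hy, ZMod.val_zero, Nat.zero_mod])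
  have h1 : θ ⟨x₀, μ⟩ = s := hval x₀ μ rfl
  have h2 : θ ⟨x₀.shift μ, ν⟩ = s := hval _ ν (by rw [B10StarCount.shift_apply_ne x₀ hμν.symm])
  have h3 : θ ⟨x₀.shift ν, μ⟩ = s := hval _ μ (by rw [B10StarCount.shift_apply_ne x₀ hμν])
  have h4 : θ ⟨x₀, ν⟩ = s := hval x₀ ν rfl
  simp only [holT_cons_true, holT_cons_false, holT_nil, mul_one]
  rw [unshift_shift_shift x₀ hμν, B10StarCount.unshift_shift]
  rw [expHermField_apply, expHermField_apply, expHermField_apply, expHermField_apply]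
  simp only []
  rw [h1, h2, h3, h4, expHerm_smul_pauli_inv, expHerm_smul_pauli_inv, mul_assoc, mul_assoc]

/-- The same holonomy as a MATRIX, in Euler form: `P_{μν}(s) = (c·1 + i d·σ_μ)(c·1 + i d·σ_ν)(c·1 − i d·σ_μ)(c·1 − i d·σ_ν)`, `c = cos s`, `d = sin s`.
[cite: Balaban1985Averaging, (9) p.18; Balaban1985UV3, p. 260] -/
theorem coe_holT_plaquette_origin (s : ℝ) (θ : PBond (F.P K) 0 → ℝ)
    (hθ : ∀ b : PBond (F.P K) 0, (b.src b.dir).val % F.L = 0 → θ b = s) {μ ν : Fin (F.P K).d} (hμν : μ ≠ ν) :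
    ((holT (bgUnits F K (expHermField (F := F) (K := K) (fun b => ((θ b : ℝ) : ℂ) • spinHalfPauli b.dir))) (fun _ => 0)
        [(μ, true), (ν, true), (μ, false), (ν, false)] : (Matrix (Fin 2) (Fin 2) ℂ)ˣ) : Matrix (Fin 2) (Fin 2) ℂ) =
      (((Real.cos s : ℝ) : ℂ) • (1 : Matrix (Fin 2) (Fin 2) ℂ) + (Complex.I * ((Real.sin s : ℝ) : ℂ)) • spinHalfPauli μ) *
      (((Real.cos s : ℝ) : ℂ) • (1 : Matrix (Fin 2) (Fin 2) ℂ) + (Complex.I * ((Real.sin s : ℝ) : ℂ)) • spinHalfPauli ν) *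
      (((Real.cos s : ℝ) : ℂ) • (1 : Matrix (Fin 2) (Fin 2) ℂ) + (Complex.I * ((-Real.sin s : ℝ) : ℂ)) • spinHalfPauli μ) *
      (((Real.cos s : ℝ) : ℂ) • (1 : Matrix (Fin 2) (Fin 2) ℂ) + (Complex.I * ((-Real.sin s : ℝ) : ℂ)) • spinHalfPauli ν) := by
  rw [coe_holT_bgUnits, holT_plaquette_origin F K s θ hθ hμν, Submonoid.coe_mul, Submonoid.coe_mul, Submonoid.coe_mul,
    coe_expHerm_smul_pauli_eq, coe_expHerm_smul_pauli_eq, coe_expHerm_smul_pauli_eq, coe_expHerm_smul_pauli_eq, Real.cos_neg, Real.sin_neg]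

/-- The plaquette word `[+μ, +ν, −μ, −ν]` is closed. [folklore] -/
theorem walkEnd_plaquette {j : ℕ} (x : Site (F.P K) j) {μ ν : Fin (F.P K).d} (hμν : μ ≠ ν) :
    walkEnd x [(μ, true), (ν, true), (μ, false), (ν, false)] = x := by
  show (((x.shift μ).shift ν).unshift μ).unshift ν = x
  rw [unshift_shift_shift x hμν, B10StarCount.unshift_shift]

/-- ★★ **(N5) «A `D_{U_s}`-PARALLEL GAUGE PARAMETER IS A CONSTANT SCALAR» — px12 g11's SPEC-0 e654b2a4 `spec_parallel_is_scalar` token for token** (explicit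
stratum-(c) family v2.1 8aced68d; for `0 < s ≤ 1`).  Proof: §4 parallelism from `D = 0`; §2 at the origin with the `(0,1)`- and `(0,2)`-plaquettes (`cos s, sin s > 0`
since `0 < s ≤ 1 < π∕2`); §3 propagation. [cite: Balaban1985BackgroundPropagators, (3.3) p.391, (3.21) p.394; Balaban1985Averaging, (8)-(9) pp.18-19] -/
theorem parallel_is_scalar (n : ℕ) (c₀ : ℝ) [Fact (0 < c₀)] (s : ℝ) (hs0 : 0 < s) (hs : s ≤ 1)
    (l : Site (F.P K) 0 → Matrix (Fin 2) (Fin 2) ℂ)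
    (hl : DL2 F n K c₀ (expHermField (F := F) (K := K)
      (fun b : PBond (F.P K) 0 =>
        (((s * (if (b.src b.dir).val % F.L = 0 then (1 : ℝ) else if (b.src b.dir).val % F.L = 1 then -1 else 0)) : ℝ) : ℂ) •
          spinHalfPauli b.dir)) (toL2S F K c₀ l) = 0) : ∃ z : ℂ, l = fun _ => z • (1 : Matrix (Fin 2) (Fin 2) ℂ) := by
  -- the family as `θ`-weighted one-axis exponents, `θ = s` where the relevant coordinate is `0 (mod L)`
  set θ : PBond (F.P K) 0 → ℝ := fun b =>
    s * (if (b.src b.dir).val % F.L = 0 then (1 : ℝ) else if (b.src b.dir).val % F.L = 1 then -1 else 0) with hθdef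
  have hθ : ∀ b : PBond (F.P K) 0, (b.src b.dir).val % F.L = 0 → θ b = s := by
    intro b hb; simp only [hθdef, hb, if_true, mul_one]
  set U : GaugeField (F.P K) 0 (Matrix.specialUnitaryGroup (Fin 2) ℂ) :=
    expHermField (F := F) (K := K) (fun b => ((θ b : ℝ) : ℂ) • spinHalfPauli b.dir) with hUdef
  have hpar := parallel_of_DL2_eq_zero F K n c₀ U l hl
  -- the positivity of `cos s`, `sin s`
  have hc : 0 < Real.cos s := Real.cos_pos_of_mem_Ioo ⟨by linarith [Real.pi_gt_three], by linarith [Real.pi_gt_three]⟩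
  have hd : 0 < Real.sin s := Real.sin_pos_of_pos_of_lt_pi hs0 (by linarith [Real.pi_gt_three])
  -- the value at the origin commutes with the two plaquette holonomies
  have h01ne : (0 : Fin 3) ≠ 1 := by decide
  have h02ne : (0 : Fin 3) ≠ 2 := by decide
  have hcomm := fun (ν : Fin 3) (hν : (0 : Fin 3) ≠ ν) =>
    commute_holT_of_parallel (bgUnits F K U) l hpar [((0 : Fin 3), true), (ν, true), ((0 : Fin 3), false), (ν, false)] (fun _ => 0)
      (walkEnd_plaquette F K (fun _ => 0) hν)
  have hc01 := hcomm 1 h01ne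
  have hc02 := hcomm 2 h02ne
  rw [hUdef, coe_holT_plaquette_origin F K s θ hθ h01ne] at hc01
  rw [hUdef, coe_holT_plaquette_origin F K s θ hθ h02ne] at hc02
  rw [Complex.ofReal_neg] at hc01 hc02
  rw [euler_zero_neg_eq, euler_one_neg_eq, euler_zero_eq, euler_one_eq] at hc01
  rw [euler_zero_neg_eq, euler_two_neg_eq, euler_zero_eq, euler_two_eq] at hc02
  obtain ⟨z, hz⟩ := eq_smul_one_of_commute_plaquettes hc hd hc01.eq hc02.eq
  exact ⟨z, eq_const_smul_one_of_parallel (bgUnits F K U) l hpar hz⟩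

end Member

end Summit.QuantumFields.YangMills.Theorems.Prop7HPcolNegIrreducible

end
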